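import Literature.AnabelianGeometry.EtaleTheta.Discharge.Sec5Cor512OfConnectedTemperoid
import Literature.AnabelianGeometry.EtaleTheta.FrobenioidThetaBiKummerOfModel
import Literature.AlgebraicGeometry.Frobenioids.IsotropicFrobeniusTrivial
import Literature.AlgebraicGeometry.Frobenioids.ModelFrobenioidPreSteps
import Literature.AlgebraicGeometry.Frobenioids.ModelFrobenioidRationallyStandardProofs

/-!
# [EtTh] Corollary 5.12 at the GENUINE §5 data AND the genuine Prop. 5.2 (i) vocabulary: (ii) UNCONDITIONAL,
# the whole Corollary modulo print's §1 line-bundle sentence only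

Mochizuki, *The étale theta function and its Frobenioid-theoretic manifestations*, Publ. RIMS **45** (2009), Cor. 5.12
pp.339–340 (PDF pp.113–114), proof p.341 l.1–9 (PDF p.115); Prop. 4.2 (iii) p.314 (PDF p.88) (an `N'`-th root of a right
fraction-pair: "`α` is of base-Frobenius type … `s'_N, s''_N : A_N → B_N` are base-equivalent pre-steps", with Def. 4.1 (iv)(a)
p.313 (PDF p.87): the domain `A_{N'}` of `α` "is Frobenius-trivial, Galois"), Prop. 4.2 (iv) p.315 (PDF p.89) (roots are determined
up to isomorphisms `ζ_A`, `ζ_B`)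
[cite: MochizukiEtTh2009, Cor 5.12 p.339–341 (PDF pp.113–115); Prop 4.2 (iii)(iv) p.314–315 (PDF pp.88–89); Def 4.1 (iv) p.313 (PDF p.87)].

PROOF-ONLY sequel (cell abc-iut, block F, seat abc-iut-f-112 gen 3; FACT-LIST rows F-0503 `ConstantMultiple.ExistsLinearIota`,
F-0502 `ConstantMultipleIndeterminacyOfSystems`) of `Sec5Cor512OfConnectedTemperoid.lean` (p444710).  There the Cor. 5.12 datum
`Rm : RootMorphismData 𝔉 Vv` ranged over an ARBITRARY Prop. 5.2 (i) vocabulary stub `Vv`, so the two Prop. 4.2 (iii) clauses about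
the `N'`-datum — `hA'` (`A_{N'}` Frobenius-trivial), `hs'` (`s^⊓_{N'}` a pre-step) — stayed binders.  At abc-iut-L2-t4's GENUINE
vocabulary `Vv := BiKummerVocabStub.ofBiKummerSetting S pf 𝔉 e` (`FrobenioidThetaBiKummerOfModel.lean`: "`(s, s')` is an
`M`-th root of a right fraction-pair of `f`" := `S.PairIsNthRootOf` — there IS an `M`-th root `R'` (Prop. 4.2 (iii)) with
isomorphisms `ζ_A : A'_M ⥲ A_{N'}`, `ζ_B : B'_M ⥲ B_{N'}` carrying `(s'_M, s''_M)` to `(s^⊓_{N'}, s^⊔_{N'})`), the field `Rm.isRoot`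
("an `N'`-th root of a right fraction-pair of an `l`-th root of `Θ̈`") DELIVERS both: `A'_M` is Frobenius-trivial (Def. 4.1 (iv)(a),
`R'.αData.isFrobeniusTrivial`), transported along `ζ_A` ([FrdI] Def. 1.2 (iv) is isomorphism-invariant in a Frobenioid — abc-iut-L1's
`IsFrobeniusTrivial.of_iso`, the model IS a Frobenioid by `ModelFrobenioid.Hypotheses.isFrobenioid`); and
`s^⊓_{N'} = ζ_A⁻¹ ∘ s'_M ∘ ζ_B` is a pre-step (abc-iut-L1's `isPreStep_comp_of_isIso(')`).  Hence at the genuine datum over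
`B^temp(Π^tp_X)⁰` with the genuine vocabulary: **Cor. 5.12 (ii) holds UNCONDITIONALLY**, and **Cor. 5.12 in full holds modulo ONLY
`hL`, `hL'`** — print's §1 sentence "all positive tensor powers of these line bundles are nontrivial" (p.341 l.5–6), an input
about line bundles of positive degree on the tempered covering that the interface does not express (sub-DAG C512-L02).
`e` (identification of `𝔉`'s and `S`'s birational units) and `pf` (pull-back of birational units) are arbitrary.
No definition, no new `Prop`, no instance; nothing landed is edited; nothing asserts such data exist for an actual curve;
Cor. 5.12 is outside the [IUTchIII] Cor. 3.12 cone and no side is taken on Cor. 3.12; typed ≠ proved except the theorems below.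
-/

noncomputable section

namespace Literature.AnabelianGeometry.EtaleTheta

open CategoryTheory Opposite Literature.AlgebraicGeometry.Frobenioids Literature.AnabelianGeometry.SemiGraphs

universe u₀ v₀ w

namespace ThetaFrobenioid

variable {K : Type u₀} [Field K] {X : SemiGraphs.TemperedArithmeticGroup.{u₀} K} {D₀ : Type u₀} [Category.{v₀} D₀]
  {V : FrdIMonoidStub.{w}} {T₀ : RealifiedDivisorMonoids (D₀ := D₀) V}
  {VD : FrdICatStub.{u₀ + 1, u₀, w} (ConnectedPart (BTemp X.Pi))}
  {tf : TemperedFrobenioid T₀ (ConnectedPart (BTemp X.Pi)) VD} {hZ : tf.monoidType = MonoidType.Z}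
  {hP : ∀ A : (ConnectedPart (BTemp X.Pi))ᵒᵖ, IsPerfect (tf.Φ.carrier A)}
  {NH : Subgroup (Field.absoluteGaloisGroup K) → tf.category → ℕ+ → Prop} {A₀ : tf.category}
  {hA₀ : PreFrobenioid.IsFrobeniusTrivial tf.toElem A₀} {hA₀' : SemiGraphs.IsGaloisObj A₀.base.obj}
  {pullFrac : ∀ {A A' : (BiKummerSetting.mkOfConnectedTemperoid X tf hZ hP NH A₀ hA₀ hA₀').C} (_ : A' ⟶ A),
    (BiKummerSetting.mkOfConnectedTemperoid X tf hZ hP NH A₀ hA₀ hA₀').biratUnits A →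
      (BiKummerSetting.mkOfConnectedTemperoid X tf hZ hP NH A₀ hA₀ hA₀').biratUnits A'}
  {lv N : ℕ+} {T : ThetaEnvData.{max u₀ w} N}
  {θ : (BiKummerSetting.mkOfConnectedTemperoid X tf hZ hP NH A₀ hA₀ hA₀').biratUnits
    (BiKummerSetting.mkOfConnectedTemperoid X tf hZ hP NH A₀ hA₀ hA₀').Aodot}
  {Bl : (BiKummerSetting.mkOfConnectedTemperoid X tf hZ hP NH A₀ hA₀ hA₀').C}
  {Pl : (BiKummerSetting.mkOfConnectedTemperoid X tf hZ hP NH A₀ hA₀ hA₀').FractionPair θ Bl}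
  {Rl : (BiKummerSetting.mkOfConnectedTemperoid X tf hZ hP NH A₀ hA₀ hA₀').NthRoot θ Pl lv pullFrac}
  (h : ModelFrobenioid.Hypotheses tf.divisorMonoid tf.ratFnFunctor)
  (Q : FrobenioidTheta.ThetaSubquotientStub.{w} (ConnectedPart (BTemp X.Pi))) (odd_l : Odd (lv : ℕ))
  (R : (BiKummerSetting.mkOfConnectedTemperoid X tf hZ hP NH A₀ hA₀ hA₀').NthRoot Rl.root Rl.pair N pullFrac)
  (ιX : T.PiX ≃ₜ* X.Pi) (K' : Type w) [Field K'] (constEmb : K'ˣ →* tf.biratUnitsModel R.BN)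
  (constEmb_injective : Function.Injective constEmb)
  (hinvc : ∀ g : Aut R.AN.base,
    pull tf.divisorMonoid g.hom (ModelFrobenioid.div R.pair.num) = ModelFrobenioid.div R.pair.num)
  (hinvp : ∀ y : T.PiX, y ∈ T.PiYdd →
    pull tf.divisorMonoid ((BiKummerSetting.mkOfConnectedTemperoid X tf hZ hP NH A₀ hA₀ hA₀').galoisSurj R.AN.base
      R.αData.isGalois (ιX y)).hom (ModelFrobenioid.div R.pair.den) = ModelFrobenioid.div R.pair.den)
  (pf : ∀ {A A' : (BiKummerSetting.mkOfConnectedTemperoid X tf hZ hP NH A₀ hA₀ hA₀').C} (_ : A' ⟶ A),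
    (BiKummerSetting.mkOfConnectedTemperoid X tf hZ hP NH A₀ hA₀ hA₀').biratUnits A →
      (BiKummerSetting.mkOfConnectedTemperoid X tf hZ hP NH A₀ hA₀ hA₀').biratUnits A')
  (e : ∀ A : (BiKummerSetting.mkOfConnectedTemperoid X tf hZ hP NH A₀ hA₀ hA₀').C,
    (ofConnectedTemperoidData h Q odd_l R ιX K' constEmb constEmb_injective hinvc hinvp).biratUnits A ≃*
      (BiKummerSetting.mkOfConnectedTemperoid X tf hZ hP NH A₀ hA₀ hA₀').biratUnits A)
  (Rm : ConstantMultiple.RootMorphismData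
    (ofConnectedTemperoidData h Q odd_l R ιX K' constEmb constEmb_injective hinvc hinvp)
    (FrobenioidThetaBiKummer.BiKummerVocabStub.ofBiKummerSetting
      (BiKummerSetting.mkOfConnectedTemperoid X tf hZ hP NH A₀ hA₀ hA₀') pf
      (ofConnectedTemperoidData h Q odd_l R ιX K' constEmb constEmb_injective hinvc hinvp) e))

/-- **`A_{N'}` IS Frobenius-trivial** at the genuine vocabulary: `Rm.isRoot` yields an `N'`-th root `R'` with `ζ_A : A'_{N'} ⥲ A_{N'}`
(Prop. 4.2 (iii)/(iv)); `A'_{N'}` is Frobenius-trivial (Def. 4.1 (iv)(a)) and Frobenius-triviality passes along `ζ_A` in the Frobenioid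
`C` ([FrdI] Def. 1.2 (iv); Thm. 5.2 (ii)).  [cite: MochizukiEtTh2009, Prop 4.2 (iii) p.314 (PDF p.88); Def 4.1 (iv) p.313 (PDF p.87)] -/
theorem isFrobeniusTrivial_AN'_ofBiKummerSetting :
    (ofConnectedTemperoidData h Q odd_l R ιX K' constEmb constEmb_injective hinvc hinvp).IsFrobeniusTrivial Rm.AN' := by
  obtain ⟨A', g, -, hroot⟩ := Rm.isRoot
  obtain ⟨hM, B', P', R', ζA, ζB, -, -⟩ := hroot
  exact (PreFrobenioidData.ofFunctor_isFrobeniusTrivial _ _).mpr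
    (PreFrobenioid.IsFrobeniusTrivial.of_iso _ (h.isFrobenioid (DivB := tf.divBNatTrans)) ζA
      R'.αData.isFrobeniusTrivial)

/-- **`s^⊓_{N'}` IS a pre-step** at the genuine vocabulary: `s^⊓_{N'} = ζ_A⁻¹ ∘ s'_{N'} ∘ ζ_B` with `s'_{N'}` a pre-step
(Prop. 4.2 (iii)) and `ζ_A`, `ζ_B` isomorphisms (Prop. 4.2 (iv)).  [cite: MochizukiEtTh2009, Prop 4.2 (iii)(iv) p.314–315 (PDF pp.88–89)] -/
theorem isPreStep_sCap'_ofBiKummerSetting :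
    (ofConnectedTemperoidData h Q odd_l R ιX K' constEmb constEmb_injective hinvc hinvp).IsPreStep Rm.sCap' := by
  obtain ⟨A', g, -, hroot⟩ := Rm.isRoot
  obtain ⟨hM, B', P', R', ζA, ζB, h1, -⟩ := hroot
  rw [← h1]
  exact (PreFrobenioidData.ofFunctor_isPreStep _ _).mpr
    (ModelFrobenioid.isPreStep_comp_of_isIso' ζA.inv (ModelFrobenioid.isPreStep_comp_of_isIso R'.pair.isPreStep_num ζB.hom))

/-- **[EtTh] Cor. 5.12 (ii) at the GENUINE §5 data with the GENUINE Prop. 5.2 (i) vocabulary — UNCONDITIONAL** (F-0503 instance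
form): "There exists a linear morphism `ι : B_{N'} → B_N`" for every Cor. 5.12 datum `Rm` (print's construction, p.341 l.6–8, via
gen 2's `existsLinearIota_of_model`; `B` group-like is `h.isGroupLike_rat`).  [cite: MochizukiEtTh2009, Cor 5.12 (ii) p.340 (PDF p.114), proof p.341 (PDF p.115)] -/
theorem existsLinearIota_ofBiKummerSetting : ConstantMultiple.ExistsLinearIota Rm :=
  existsLinearIota_ofConnectedTemperoidData h Q odd_l R ιX K' constEmb constEmb_injective hinvc hinvp Rm
    (isFrobeniusTrivial_AN'_ofBiKummerSetting h Q odd_l R ιX K' constEmb constEmb_injective hinvc hinvp pf e Rm)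
    (isPreStep_sCap'_ofBiKummerSetting h Q odd_l R ιX K' constEmb constEmb_injective hinvc hinvp pf e Rm)

/-- **[EtTh] Cor. 5.12 — (i), (ii), (iii) — at the GENUINE §5 data with the GENUINE vocabulary, modulo ONLY print's §1 sentence**
"all positive tensor powers of these line bundles are nontrivial" (p.341 l.5–6) in model form (`hL`: the class of `B_N` is not in
`Div_B(B(B_N^bs))`; `hL'`: no positive power of the class of `B_{N'}` is) (F-0502 instance form).
[cite: MochizukiEtTh2009, Cor 5.12 p.339–341 (PDF pp.113–115)] -/
theorem constantMultipleIndeterminacyOfSystems_ofBiKummerSetting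
    (hL : ∀ u : tf.ratFnFunctor.obj (op R.BN.base),
      R.BN.cls ≠ divB tf.divisorMonoid tf.ratFnFunctor tf.divBNatTrans (op R.BN.base) u)
    (hL' : ∀ k : ℕ, 0 < k → ∀ u : tf.ratFnFunctor.obj (op Rm.BN'.base),
      Rm.BN'.cls ^ k ≠ divB tf.divisorMonoid tf.ratFnFunctor tf.divBNatTrans (op Rm.BN'.base) u) :
    ConstantMultiple.ConstantMultipleIndeterminacyOfSystems Rm :=
  constantMultipleIndeterminacyOfSystems_ofConnectedTemperoidData h Q odd_l R ιX K' constEmb constEmb_injective hinvc hinvp Rm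
    (isFrobeniusTrivial_AN'_ofBiKummerSetting h Q odd_l R ιX K' constEmb constEmb_injective hinvc hinvp pf e Rm)
    (isPreStep_sCap'_ofBiKummerSetting h Q odd_l R ιX K' constEmb constEmb_injective hinvc hinvp pf e Rm) hL hL'

end ThetaFrobenioid

end Literature.AnabelianGeometry.EtaleTheta

end
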